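import Summits.HodgeConjecture.HodgeConjecture.Theorems.Ring2AbelianAllAndreInvariantHomNumExact
import Summits.HodgeConjecture.HodgeConjecture.Theorems.Ring2AbelianAllAndreHodgeLatticeTotal
import Summits.HodgeConjecture.HodgeConjecture.Theorems.Ring2AbelianAllConstantPencils
import Summits.HodgeConjecture.HodgeConjecture.Theorems.Ring2AbelianAllFrameCrossBranch
import HarnessLib

/-!
# Ring 2 · sub-cell AbelianAll (ALL ABELIAN VARIETIES), spreading axis (seat ab-spread-1), part XXXI — THE HODGE-INPUT
# FACES OF THE ANDRÉ-AXIS CANDIDATES ARE PIVOTS, NOT COMPLEMENTS: each CONTAINS `HC_CM` outright (constant pencils,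
# no named fact) and each is EQUIVALENT to `HC_AV` modulo Lemme 6.3.1 (and Verdier where the landed converse needs it)

HONEST FRAMING (page 1, verbatim): **research route, not a corollary; conditional on HC_CM plus one named
minimal statement.** Cell line: research route conditional on HC_CM; not a corollary; Q11.4-sentence-2
already refuted in dim ≥ 3. Nothing in this file proves a case of the Hodge conjecture for an abelian variety:
every row is an implication between statements already displayed in the tree. `HC_CM` = `Theses.RankFourFaces.CMAbelianHodge`,
`HC_AV` = `Theses.PadicSemiregularLift.HodgeAbelianVarieties`; `h₂₁` = André's Lemme 6.3.1 (`andre1996_cmAnchoredPencil`) and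
`hGT` = Verdier's generic local triviality are NAMED-FACT BINDERS; item `Theses.RankFourFaces.CMToAbelian`
(stmt-HodgeConjecture-16267) OPEN and not closed here. The cell's `B_min` of record is unchanged (N104
`MiddleHodgeFailureSpreadsToCMFibre`); nothing is claimed minimal; NO node is born (0 `def`).

## The finding (KIND column of the spreading-axis census; watershed of SPREAD.md §2 sharpened)

Parts XVII-f, XVIII-f and XXX-d/f (seat ab-andre-2) display, next to the ALGEBRAIC-input candidates (4), (L), Num^{CM,inv},
Det^CM, Div^CM, four HODGE-input forms and the exactness rows `HC_AV ⟺ HC_CM ∧ F` (mod `h₂₁` [, `hGT`]):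
* F₁ (XVII-f `HC_AV_iff_HC_CM_and_comap_eq_hodge`): on every CM-pointed compact pencil, `C_s = D_s` for every `s`
  ("the classes of the total space algebraic on `𝒳_s` are exactly the Hodge-invariant ones");
* F₂ (XVIII-f `HC_AV_iff_HC_CM_and_span_hodge_le_comap`): on every CM-pointed compact pencil, `T_p(𝒳) ≤ C_s` for every `s`
  ("every rational `(p,p)`-class of the total space is algebraic on every fibre");
* F₃ (XVIII-f `cmFibreAlgebraicLift_iff_span_hodge_le_sup_of_HC_CM`): at every CM point `t`, `T_p(𝒳) ≤ N^p(𝒳) ⊔ ker j_t^*`;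
* F₄ (XXX-d `HC_AV_of_HC_CM_of_finrank`, XXX-f `HC_AV_iff_HC_CM_and_finrank_of_verdier`): at every CM point `t`,
  `dim ((Hdg^p(X_t) ⊗ ℂ) ∩ Im j_t^*) ≤ dim j_t^* N^p(𝒳)` — worded there "the André-axis complement of `HC_CM`".
THIS FILE PROVES: (a) **`Fᵢ → HC_CM` with NO named fact** (`HC_CM_of_comap_eq_hodge`, `HC_CM_of_span_hodge_le_comap`,
`HC_CM_of_span_hodge_le_sup`, `HC_CM_of_finrank_hodge_le`) — on the CONSTANT pencil `A × E₀ ⟶ E₀` through a CM abelian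
variety `A` (part IV of ab-andre-1: `isCompactAbelianPencil_snd`, `mem_cmLocus_snd`, slice chart `exists_sliceFiberIso`)
every point is a CM point and `j_t^* ∘ pr₁^*` is the chart isomorphism, so each `Fᵢ` read at the origin is the Hodge
conjecture for `A`; hence the conjunct `HC_CM ∧` of the four exactness rows is REDUNDANT and (b) **`HC_AV ⟺ Fᵢ`**
(`HC_AV_iff_comap_eq_hodge_of_andre1996`, `HC_AV_iff_span_hodge_le_comap_of_andre1996` mod `h₂₁` alone;
`HC_AV_iff_span_hodge_le_sup_of_verdier`, `HC_AV_iff_finrank_hodge_le_of_verdier` mod [`h₂₁`, `hGT`]) — the Hodge-input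
faces are PIVOTS (`PivotAV`, the LEAD's frame part III), i.e. KIND 1 ("`HC_CM` idle"), not complements of `HC_CM`;
(c) F₃, F₄ imply the lift node (L) UNCONDITIONALLY (`cmFibreAlgebraicLift_of_span_hodge_le_sup`,
`cmFibreAlgebraicLift_of_finrank_hodge_le`), and `h₂₁ → F₄ → HC_AV` has a direct proof using neither `HC_CM` nor
Lemmes 6.3.2–6.3.3 nor a junction (`HC_AV_of_andre1996_of_finrank_hodge_le'`: Lemme 6.3.1's global class is fibrewise
Hodge, so at the CM point it lies in `(Hdg ⊗ ℂ) ∩ Im j_t^* = j_t^* N^p(𝒳)` and the algebraic lift spreads).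
READING for the census: the watershed on the André axis is ALGEBRAIC input versus HODGE input AT THE CM FIBRE — a candidate
whose CM-fibre input is "Hodge" already contains `HC_CM` (KIND 1); only the algebraic-input candidates ((4), (L), (L∀),
Num^{CM,inv}, Det^CM, Div^CM, the algebraic rank form of XXX-d §2) are complements of `HC_CM` (KIND 2). Count once (ab-spread-1).

References: Andre1996Motifs (Lemme 6.3.1 p. 31, §6.3 a), Remarque 2 p. 33); Verdier1976 (Cor. 5.1); Milne2020HodgeClassesAV
(Prop. 1 p. 7); Fulton1998 (§10.1, §19.2); CharlesSchnell2014Notes (Prop. 11.3.5); GrothendieckTopology1969 (§1).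
-/

noncomputable section

set_option linter.dupNamespace false

namespace Summit.HodgeConjecture.HodgeConjecture.Ring2.AbelianAll

open CategoryTheory AlgebraicGeometry MonoidalCategory
open Literature.AlgebraicGeometry Literature.AlgebraicGeometry.Motives
open Literature.AlgebraicGeometry.HodgeTheory
open Literature.AlgebraicGeometry.Deligne1982 (cmLocus)
open Literature.AlgebraicGeometry.Milne1999 (IsOfCMType)
open Literature.NumberTheory.EllipticCurves (CMEndomorphism.exists_cmCurve_sqrt_neg)
open Literature.AlgebraicGeometry.Andre1996 (andre1996_cmAnchoredPencil)
open Summit.HodgeConjecture.HodgeConjecture.Theses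
open Summit.HodgeConjecture.HodgeConjecture.Ring2.Deform (HC_CM_of_HC_AV)
open Summit.HodgeConjecture.HodgeConjecture.Theorems.HodgeAbelianVarieties.Negative (iff_hodgeConjecture_restricted)

variable {𝒳 S : SchemeOver ℂ} {d : ℕ} {f : 𝒳 ⟶ S}

/-! ## §0 The constant CM pencil reads a Hodge class of `A` as an invariant Hodge class of a CM fibre (no hypothesis) -/
/-- **On the constant pencil `A × C ⟶ C`, `j_t^*(pr₁^* c)` is a rational `(p,p)`-class of the fibre whenever `c` is one of
`A`** (slice chart `e : A ≅ (A × C)_t`, `j_t^* pr₁^* = (e⁻¹)^*`; pull-backs preserve rationality and Hodge type).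
[cite: Fulton1998, §10.1] [cite: VoisinHodgeI2002, §7.3.2] -/
theorem hodge_map_fiberι_map_fst_of_eq (A : AbelianVariety ℂ) (hA : IsSmoothProjective A.dim A.X) {C : SchemeOver ℂ}
    {t : ComplexPoints C} {e : A.X ≅ fiberOver (CartesianMonoidalCategory.snd A.X C) t}
    (he : e.hom ≫ fiberι (CartesianMonoidalCategory.snd A.X C) t = sliceAt A.X t) {p : ℕ} {c : complexBetti A.X (2 * p)}
    (hc : IsRationalClass c) (hpp : IsOfHodgeType A.dim A.X (2 * p) p p c) :
    IsRationalClass (complexBetti.map (fiberι (CartesianMonoidalCategory.snd A.X C) t) (2 * p)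
        (complexBetti.map (CartesianMonoidalCategory.fst A.X C) (2 * p) c)) ∧
      IsOfHodgeType A.dim (fiberOver (CartesianMonoidalCategory.snd A.X C) t) (2 * p) p p
        (complexBetti.map (fiberι (CartesianMonoidalCategory.snd A.X C) t) (2 * p)
          (complexBetti.map (CartesianMonoidalCategory.fst A.X C) (2 * p) c)) := by
  rw [complexBetti_map_fiberι_map_fst_of_eq he]
  exact ⟨hc.pullback _, hpp.map_of_isSmoothProjective (hA.of_iso e) hA _⟩

/-- **On the constant pencil, "`j_t^*(pr₁^* c)` algebraic on the fibre" is "`c` algebraic on `A`"** (transport along the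
slice chart). [cite: GrothendieckTopology1969, §1] [cite: Fulton1998, §10.1] -/
theorem mem_algebraicClasses_of_map_fiberι_map_fst_of_eq (A : AbelianVariety ℂ) {C : SchemeOver ℂ} {t : ComplexPoints C}
    {e : A.X ≅ fiberOver (CartesianMonoidalCategory.snd A.X C) t}
    (he : e.hom ≫ fiberι (CartesianMonoidalCategory.snd A.X C) t = sliceAt A.X t) {p : ℕ} {c : complexBetti A.X (2 * p)}
    (h : complexBetti.map (fiberι (CartesianMonoidalCategory.snd A.X C) t) (2 * p)
        (complexBetti.map (CartesianMonoidalCategory.fst A.X C) (2 * p) c) ∈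
      algebraicClasses (fiberOver (CartesianMonoidalCategory.snd A.X C) t) p) :
    c ∈ algebraicClasses A.X p := by
  rw [complexBetti_map_fiberι_map_fst_of_eq he] at h
  exact (mem_algebraicClasses_map_iff_of_iso e.symm).1 h

/-! ## §1 F₄ — the Hodge rank form (parts XXX-d/f) -/

/-- The Hodge rank inequality at `t` forces **`j_t^* N^p(𝒳) = (Hdg^p(X_t) ⊗ ℂ) ∩ Im j_t^*`** — NO `HC_CM`, no named fact:
`j_t^* N^p(𝒳) ≤ N^p(X_t) ∩ Im j_t^* ≤ (Hdg ⊗ ℂ) ∩ Im j_t^*` unconditionally (`map_algebraicClasses_le_inf_range`,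
`algebraicClasses_le_span_hodgeClasses`), and nested finite-dimensional subspaces of equal dimension coincide.
[cite: Milne2020HodgeClassesAV, Prop. 1 (p. 7)] [cite: Deligne2000, §1] -/
theorem map_algebraicClasses_eq_hodgeSpan_inf_range_of_finrank_hodge_le (hf : IsCompactAbelianPencil f d)
    (t : ComplexPoints S) (p : ℕ)
    (h : Module.finrank ℂ ↥(Submodule.span ℂ {c : complexBetti (fiberOver f t) (2 * p) |
            IsRationalClass c ∧ IsOfHodgeType d (fiberOver f t) (2 * p) p p c} ⊓
          LinearMap.range (complexBetti.map (fiberι f t) (2 * p)).hom) ≤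
        Module.finrank ℂ ↥((algebraicClasses 𝒳 p).map (complexBetti.map (fiberι f t) (2 * p)).hom)) :
    (algebraicClasses 𝒳 p).map (complexBetti.map (fiberι f t) (2 * p)).hom =
      Submodule.span ℂ {c : complexBetti (fiberOver f t) (2 * p) |
          IsRationalClass c ∧ IsOfHodgeType d (fiberOver f t) (2 * p) p p c} ⊓
        LinearMap.range (complexBetti.map (fiberι f t) (2 * p)).hom := by
  haveI := finite_complexBetti (hf.isSmoothProjective_fiberOver t) (2 * p)
  exact Submodule.eq_of_le_of_finrank_le
    (le_trans (map_algebraicClasses_le_inf_range hf t p)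
      (inf_le_inf_right _ (algebraicClasses_le_span_hodgeClasses (hf.isSmoothProjective_fiberOver t) p))) h

/-- Hence the Hodge rank inequality at `t` gives **(L)_t(p), with NO `HC_CM`** (part XXX-d's
`comap_le_sup_iff_finrank_hodge_le_of_HC_CM` carries `HC_CM` as a binder in both directions; this direction needs none).
[cite: Milne2020HodgeClassesAV, Prop. 1 (p. 7)] [cite: Andre1996Motifs, §5.1 (p. 25)] -/
theorem comap_le_sup_of_finrank_hodge_le (hf : IsCompactAbelianPencil f d) (t : ComplexPoints S) (p : ℕ)
    (h : Module.finrank ℂ ↥(Submodule.span ℂ {c : complexBetti (fiberOver f t) (2 * p) |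
            IsRationalClass c ∧ IsOfHodgeType d (fiberOver f t) (2 * p) p p c} ⊓
          LinearMap.range (complexBetti.map (fiberι f t) (2 * p)).hom) ≤
        Module.finrank ℂ ↥((algebraicClasses 𝒳 p).map (complexBetti.map (fiberι f t) (2 * p)).hom)) :
    (algebraicClasses (fiberOver f t) p).comap (complexBetti.map (fiberι f t) (2 * p)).hom ≤
      algebraicClasses 𝒳 p ⊔ LinearMap.ker (complexBetti.map (fiberι f t) (2 * p)).hom :=
  comap_le_sup_of_map_eq_inf_range t p <| le_antisymm (map_algebraicClasses_le_inf_range hf t p) <| by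
    rw [map_algebraicClasses_eq_hodgeSpan_inf_range_of_finrank_hodge_le hf t p h]
    exact inf_le_inf_right _ (algebraicClasses_le_span_hodgeClasses (hf.isSmoothProjective_fiberOver t) p)

/-- **F₄ ⟹ (L) unconditionally**: the Hodge rank form at the CM points implies `CMFibreAlgebraicLift`, no `HC_CM`, no fact.
[cite: Andre1996Motifs, §5.1 (p. 25) and Remarque 2 (p. 33)] -/
theorem cmFibreAlgebraicLift_of_finrank_hodge_le
    (h : ∀ ⦃d : ℕ⦄ ⦃𝒳 S : SchemeOver ℂ⦄ (f : 𝒳 ⟶ S), IsCompactAbelianPencil f d → ∀ (p : ℕ), ∀ t ∈ cmLocus f d,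
      Module.finrank ℂ ↥(Submodule.span ℂ {c : complexBetti (fiberOver f t) (2 * p) |
            IsRationalClass c ∧ IsOfHodgeType d (fiberOver f t) (2 * p) p p c} ⊓
          LinearMap.range (complexBetti.map (fiberι f t) (2 * p)).hom) ≤
        Module.finrank ℂ ↥((algebraicClasses 𝒳 p).map (complexBetti.map (fiberι f t) (2 * p)).hom)) :
    CMFibreAlgebraicLift :=
  cmFibreAlgebraicLift_iff_comap_le_sup.2 fun _ _ _ f hf p t ht ↦ comap_le_sup_of_finrank_hodge_le hf t p (h f hf p t ht)

/-- **F₄ ⟹ `HC_CM`, NO named fact** (constant pencil `A × E₀ ⟶ E₀` through the CM abelian variety `A`, `E₀ = ℂ/ℤ[i]` the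
tree's CM elliptic curve used only as a smooth projective curve): at the origin `t` (a CM point, `mem_cmLocus_snd`),
`j_t^*(pr₁^* c)` is a rational `(p,p)`-class in `Im j_t^*`, hence in `j_t^* N^p(A × E₀)` by the rank inequality (§1), hence
algebraic on the fibre, hence `c` is algebraic on `A` (§0). So the Hodge rank form CONTAINS `HC_CM`: it is not a complement of it.
[cite: Andre1996Motifs, §6.3 footnote (2) (p. 31)] [cite: Fulton1998, §10.1 and §19.2 Cor. 19.2 (b)] -/
theorem HC_CM_of_finrank_hodge_le
    (h : ∀ ⦃d : ℕ⦄ ⦃𝒳 S : SchemeOver ℂ⦄ (f : 𝒳 ⟶ S), IsCompactAbelianPencil f d → ∀ (p : ℕ), ∀ t ∈ cmLocus f d,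
      Module.finrank ℂ ↥(Submodule.span ℂ {c : complexBetti (fiberOver f t) (2 * p) |
            IsRationalClass c ∧ IsOfHodgeType d (fiberOver f t) (2 * p) p p c} ⊓
          LinearMap.range (complexBetti.map (fiberι f t) (2 * p)).hom) ≤
        Module.finrank ℂ ↥((algebraicClasses 𝒳 p).map (complexBetti.map (fiberι f t) (2 * p)).hom)) :
    RankFourFaces.CMAbelianHodge := by
  intro A hA hAcm
  refine (hodgeConjectureFor_iff_of_isSmoothProjective nonempty_hodgeModel_holds hA).2 fun p c hc hpp ↦ ?_
  obtain ⟨E₀, ψ₀, hE₀, -⟩ := CMEndomorphism.exists_cmCurve_sqrt_neg 1 one_pos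
  have hf : IsCompactAbelianPencil (CartesianMonoidalCategory.snd A.X E₀.X) A.dim :=
    isCompactAbelianPencil_snd A (isSmoothProjective_of_dim_eq' hE₀)
  obtain ⟨e, he⟩ := exists_sliceFiberIso A.X (C := E₀.X) (1 : E₀.Points ℂ)
  refine mem_algebraicClasses_of_map_fiberι_map_fst_of_eq A he (map_algebraicClasses_le_inf_range hf _ p ?_).1
  rw [map_algebraicClasses_eq_hodgeSpan_inf_range_of_finrank_hodge_le hf _ p (h _ hf p _ (mem_cmLocus_snd A hAcm _))]
  exact ⟨Submodule.subset_span (hodge_map_fiberι_map_fst_of_eq A hA he hc hpp), ⟨_, rfl⟩⟩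

/-- **`h₂₁ → F₄ → HC_AV` with NO `HC_CM`** — `hCM` in part XXX-d's `HC_AV_of_HC_CM_of_finrank` is redundant (it is supplied by
`HC_CM_of_finrank_hodge_le`). `h₂₁` is a named-fact binder. research route, not a corollary; conditional on HC_CM plus one named
minimal statement. [cite: Andre1996Motifs, Lemme 6.3.1 (p. 31) and Remarque 2 (p. 33)] [cite: Milne2020HodgeClassesAV, Prop. 1 (p. 7)] -/
theorem HC_AV_of_andre1996_of_finrank_hodge_le (h₂₁ : andre1996_cmAnchoredPencil)
    (h : ∀ ⦃d : ℕ⦄ ⦃𝒳 S : SchemeOver ℂ⦄ (f : 𝒳 ⟶ S), IsCompactAbelianPencil f d → ∀ (p : ℕ), ∀ t ∈ cmLocus f d,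
      Module.finrank ℂ ↥(Submodule.span ℂ {c : complexBetti (fiberOver f t) (2 * p) |
            IsRationalClass c ∧ IsOfHodgeType d (fiberOver f t) (2 * p) p p c} ⊓
          LinearMap.range (complexBetti.map (fiberι f t) (2 * p)).hom) ≤
        Module.finrank ℂ ↥((algebraicClasses 𝒳 p).map (complexBetti.map (fiberι f t) (2 * p)).hom)) :
    PadicSemiregularLift.HodgeAbelianVarieties :=
  HC_AV_of_HC_CM_of_finrank h₂₁ (HC_CM_of_finrank_hodge_le h) h

/-- **The same with a DIRECT proof using neither `HC_CM` nor Lemmes 6.3.2–6.3.3 nor a junction**: Lemme 6.3.1's global class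
`W` is Hodge on every fibre, so at the CM point `t` it lies in `(Hdg ⊗ ℂ) ∩ Im j_t^* = j_t^* N^p(𝒳)` (§1); the algebraic lift
spreads to `s` (`map_fiberι_mem_algebraicClasses_of_lift`) and André's chart and pull-back finish (as in André-axis
part I's `HC_AV_of_HC_CM_and_Bmin`, minus its only use of `HC_CM`). [cite: Andre1996Motifs, Lemme 6.3.1 (p. 31) and §6.3 a) (p. 33)]
[cite: Abdulali1994FamiliesAV, Lemma 6.2 (p. 1131)] -/
theorem HC_AV_of_andre1996_of_finrank_hodge_le' (h₂₁ : andre1996_cmAnchoredPencil)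
    (h : ∀ ⦃d : ℕ⦄ ⦃𝒳 S : SchemeOver ℂ⦄ (f : 𝒳 ⟶ S), IsCompactAbelianPencil f d → ∀ (p : ℕ), ∀ t ∈ cmLocus f d,
      Module.finrank ℂ ↥(Submodule.span ℂ {c : complexBetti (fiberOver f t) (2 * p) |
            IsRationalClass c ∧ IsOfHodgeType d (fiberOver f t) (2 * p) p p c} ⊓
          LinearMap.range (complexBetti.map (fiberι f t) (2 * p)).hom) ≤
        Module.finrank ℂ ↥((algebraicClasses 𝒳 p).map (complexBetti.map (fiberι f t) (2 * p)).hom)) :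
    PadicSemiregularLift.HodgeAbelianVarieties := by
  refine iff_hodgeConjecture_restricted.2 fun A hA ↦ ?_
  refine (hodgeConjectureFor_iff_of_isSmoothProjective nonempty_hodgeModel_holds hA).2 fun p c hc hpp ↦ ?_
  obtain ⟨𝒳, S, f, hf, s, t, W, A₁, A₀, e₁, g, q, hW, hq, hgc, ⟨e₀⟩, hA₀⟩ := h₂₁ A hA p c hc hpp
  have hWt : complexBetti.map (fiberι f t) (2 * p) W ∈
      (algebraicClasses 𝒳 p).map (complexBetti.map (fiberι f t) (2 * p)).hom := by
    rw [map_algebraicClasses_eq_hodgeSpan_inf_range_of_finrank_hodge_le hf t p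
      (h f hf p t (mem_cmLocus_of_compactPencil hf e₀ hA₀))]
    exact ⟨Submodule.subset_span ⟨(hW t).1, (hW t).2⟩, ⟨W, rfl⟩⟩
  obtain ⟨η, hη, hηt⟩ := hWt
  have h₂ : complexBetti.map e₁.hom (2 * p) (complexBetti.map (fiberι f s) (2 * p) W) ∈ algebraicClasses A₁.X p :=
    (mem_algebraicClasses_map_iff_of_iso e₁).2 (map_fiberι_mem_algebraicClasses_of_lift hf hη hηt s)
  have h₃ : (q : ℂ) • c ∈ algebraicClasses A.X p := by
    rw [← hgc]; exact map_mem_algebraicClasses_of_abelianVariety hA A₁ g.hom.hom.hom h₂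
  exact (Submodule.smul_mem_iff _ (Rat.cast_ne_zero.2 hq)).1 h₃

/-- **PIVOT: `HC_AV ⟺ F₄` modulo [h₂₁, hGT]** — part XXX-f's `HC_AV_iff_HC_CM_and_finrank_of_verdier` with its redundant
conjunct `HC_CM` removed. The Hodge rank form is EQUIVALENT to `HC_AV`, not a complement of `HC_CM`. `h₂₁`, `hGT` binders.
research route, not a corollary; conditional on HC_CM plus one named minimal statement.
[cite: Andre1996Motifs, Lemme 6.3.1 (p. 31)] [cite: Verdier1976, Cor. 5.1] [cite: Milne2020HodgeClassesAV, Prop. 1 (p. 7)] -/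
theorem HC_AV_iff_finrank_hodge_le_of_verdier (h₂₁ : andre1996_cmAnchoredPencil)
    (hGT : Verdier1976_genericLocalTriviality) :
    PadicSemiregularLift.HodgeAbelianVarieties ↔
      ∀ ⦃d : ℕ⦄ ⦃𝒳 S : SchemeOver ℂ⦄ (f : 𝒳 ⟶ S), IsCompactAbelianPencil f d → ∀ (p : ℕ), ∀ t ∈ cmLocus f d,
        Module.finrank ℂ ↥(Submodule.span ℂ {c : complexBetti (fiberOver f t) (2 * p) |
              IsRationalClass c ∧ IsOfHodgeType d (fiberOver f t) (2 * p) p p c} ⊓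
            LinearMap.range (complexBetti.map (fiberι f t) (2 * p)).hom) ≤
          Module.finrank ℂ ↥((algebraicClasses 𝒳 p).map (complexBetti.map (fiberι f t) (2 * p)).hom) :=
  ⟨fun h ↦ ((HC_AV_iff_HC_CM_and_finrank_of_verdier h₂₁ hGT).1 h).2, HC_AV_of_andre1996_of_finrank_hodge_le h₂₁⟩

/-- Frame row: **F₄ is a `PivotAV`** (KIND 1 and on-path), modulo [h₂₁, hGT]. [cite: Andre1996Motifs, Remarque 2 (p. 33)] -/
theorem pivotAV_finrankHodgeCM_of_andre1996_of_verdier (h₂₁ : andre1996_cmAnchoredPencil)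
    (hGT : Verdier1976_genericLocalTriviality) :
    PivotAV (∀ ⦃d : ℕ⦄ ⦃𝒳 S : SchemeOver ℂ⦄ (f : 𝒳 ⟶ S), IsCompactAbelianPencil f d → ∀ (p : ℕ), ∀ t ∈ cmLocus f d,
      Module.finrank ℂ ↥(Submodule.span ℂ {c : complexBetti (fiberOver f t) (2 * p) |
            IsRationalClass c ∧ IsOfHodgeType d (fiberOver f t) (2 * p) p p c} ⊓
          LinearMap.range (complexBetti.map (fiberι f t) (2 * p)).hom) ≤
        Module.finrank ℂ ↥((algebraicClasses 𝒳 p).map (complexBetti.map (fiberι f t) (2 * p)).hom)) :=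
  pivotAV_iff.2 (HC_AV_iff_finrank_hodge_le_of_verdier h₂₁ hGT).symm

/-! ## §2 F₁ — the lattice face `C ≡ D` on CM-pointed compact pencils (part XVII-f) -/

/-- **F₁ ⟹ `HC_CM`, NO named fact** (constant CM pencil: `pr₁^* c ∈ D_t`, so `pr₁^* c ∈ C_t`, i.e. `j_t^* pr₁^* c` is algebraic
on the fibre, i.e. `c` is algebraic on `A`). [cite: Andre1996Motifs, §6.3 footnote (2) (p. 31)] [cite: Fulton1998, §10.1] -/
theorem HC_CM_of_comap_eq_hodge
    (h : ∀ ⦃d : ℕ⦄ ⦃𝒳 S : SchemeOver ℂ⦄ (f : 𝒳 ⟶ S) (hf : IsCompactAbelianPencil f d),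
      (cmLocus f d).Nonempty → ∀ (p : ℕ) (s : ComplexPoints S),
        (algebraicClasses (fiberOver f s) p).comap (complexBetti.map (fiberι f s) (2 * p)).hom =
          (Submodule.span ℂ {c : complexBetti (fiberOver f s) (2 * p) |
              IsRationalClass c ∧ IsOfHodgeType d (fiberOver f s) (2 * p) p p c}).comap
            (complexBetti.map (fiberι f s) (2 * p)).hom) :
    RankFourFaces.CMAbelianHodge := by
  intro A hA hAcm
  refine (hodgeConjectureFor_iff_of_isSmoothProjective nonempty_hodgeModel_holds hA).2 fun p c hc hpp ↦ ?_
  obtain ⟨E₀, ψ₀, hE₀, -⟩ := CMEndomorphism.exists_cmCurve_sqrt_neg 1 one_pos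
  have hf : IsCompactAbelianPencil (CartesianMonoidalCategory.snd A.X E₀.X) A.dim :=
    isCompactAbelianPencil_snd A (isSmoothProjective_of_dim_eq' hE₀)
  obtain ⟨e, he⟩ := exists_sliceFiberIso A.X (C := E₀.X) (1 : E₀.Points ℂ)
  refine mem_algebraicClasses_of_map_fiberι_map_fst_of_eq A he ?_
  have hD : complexBetti.map (CartesianMonoidalCategory.fst A.X E₀.X) (2 * p) c ∈
      (Submodule.span ℂ {c : complexBetti (fiberOver (CartesianMonoidalCategory.snd A.X E₀.X) (1 : E₀.Points ℂ)) (2 * p) |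
          IsRationalClass c ∧ IsOfHodgeType A.dim (fiberOver (CartesianMonoidalCategory.snd A.X E₀.X) (1 : E₀.Points ℂ))
            (2 * p) p p c}).comap
        (complexBetti.map (fiberι (CartesianMonoidalCategory.snd A.X E₀.X) (1 : E₀.Points ℂ)) (2 * p)).hom :=
    Submodule.subset_span (hodge_map_fiberι_map_fst_of_eq A hA he hc hpp)
  rw [← h _ hf ⟨_, mem_cmLocus_snd A hAcm (1 : E₀.Points ℂ)⟩ p _] at hD
  exact hD

/-- **PIVOT: `HC_AV ⟺ F₁` modulo h₂₁ ALONE** — part XVII-f's `HC_AV_iff_HC_CM_and_comap_eq_hodge` with its redundant conjunct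
`HC_CM` removed. `h₂₁` binder. research route, not a corollary; conditional on HC_CM plus one named minimal statement.
[cite: Andre1996Motifs, Lemme 6.3.1 (p. 31) and §6.3 a) (p. 33)] -/
theorem HC_AV_iff_comap_eq_hodge_of_andre1996 (h₂₁ : andre1996_cmAnchoredPencil) :
    PadicSemiregularLift.HodgeAbelianVarieties ↔
      ∀ ⦃d : ℕ⦄ ⦃𝒳 S : SchemeOver ℂ⦄ (f : 𝒳 ⟶ S) (hf : IsCompactAbelianPencil f d),
        (cmLocus f d).Nonempty → ∀ (p : ℕ) (s : ComplexPoints S),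
          (algebraicClasses (fiberOver f s) p).comap (complexBetti.map (fiberι f s) (2 * p)).hom =
            (Submodule.span ℂ {c : complexBetti (fiberOver f s) (2 * p) |
                IsRationalClass c ∧ IsOfHodgeType d (fiberOver f s) (2 * p) p p c}).comap
              (complexBetti.map (fiberι f s) (2 * p)).hom :=
  ⟨fun h ↦ ((HC_AV_iff_HC_CM_and_comap_eq_hodge h₂₁).1 h).2,
    fun h ↦ (HC_AV_iff_HC_CM_and_comap_eq_hodge h₂₁).2 ⟨HC_CM_of_comap_eq_hodge h, h⟩⟩

/-- Frame row: **F₁ is a `PivotAV`**, modulo h₂₁. [cite: Andre1996Motifs, Remarque 2 (p. 33)] -/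
theorem pivotAV_comapEqHodgeCM_of_andre1996 (h₂₁ : andre1996_cmAnchoredPencil) :
    PivotAV (∀ ⦃d : ℕ⦄ ⦃𝒳 S : SchemeOver ℂ⦄ (f : 𝒳 ⟶ S) (hf : IsCompactAbelianPencil f d),
      (cmLocus f d).Nonempty → ∀ (p : ℕ) (s : ComplexPoints S),
        (algebraicClasses (fiberOver f s) p).comap (complexBetti.map (fiberι f s) (2 * p)).hom =
          (Submodule.span ℂ {c : complexBetti (fiberOver f s) (2 * p) |
              IsRationalClass c ∧ IsOfHodgeType d (fiberOver f s) (2 * p) p p c}).comap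
            (complexBetti.map (fiberι f s) (2 * p)).hom) :=
  pivotAV_iff.2 (HC_AV_iff_comap_eq_hodge_of_andre1996 h₂₁).symm

/-! ## §3 F₂ — "every rational `(p,p)`-class of the total space is algebraic on every fibre" on CM-pointed pencils (part XVIII-f) -/

/-- **F₂ ⟹ `HC_CM`, NO named fact** (constant CM pencil: `pr₁^* c ∈ T_p(A × E₀)`, so it is algebraic on the fibre over the
origin, i.e. `c` is algebraic on `A`). [cite: Andre1996Motifs, §6.3 footnote (2) (p. 31)] [cite: VoisinHodgeI2002, §7.3.2] -/
theorem HC_CM_of_span_hodge_le_comap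
    (h : ∀ ⦃d : ℕ⦄ ⦃𝒳 S : SchemeOver ℂ⦄ (f : 𝒳 ⟶ S) (hf : IsCompactAbelianPencil f d),
      (cmLocus f d).Nonempty → ∀ (p : ℕ) (s : ComplexPoints S),
        Submodule.span ℂ {c : complexBetti 𝒳 (2 * p) | IsRationalClass c ∧ IsOfHodgeType (d + 1) 𝒳 (2 * p) p p c} ≤
          (algebraicClasses (fiberOver f s) p).comap (complexBetti.map (fiberι f s) (2 * p)).hom) :
    RankFourFaces.CMAbelianHodge := by
  intro A hA hAcm
  refine (hodgeConjectureFor_iff_of_isSmoothProjective nonempty_hodgeModel_holds hA).2 fun p c hc hpp ↦ ?_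
  obtain ⟨E₀, ψ₀, hE₀, -⟩ := CMEndomorphism.exists_cmCurve_sqrt_neg 1 one_pos
  have hf : IsCompactAbelianPencil (CartesianMonoidalCategory.snd A.X E₀.X) A.dim :=
    isCompactAbelianPencil_snd A (isSmoothProjective_of_dim_eq' hE₀)
  obtain ⟨e, he⟩ := exists_sliceFiberIso A.X (C := E₀.X) (1 : E₀.Points ℂ)
  exact mem_algebraicClasses_of_map_fiberι_map_fst_of_eq A he
    (h _ hf ⟨_, mem_cmLocus_snd A hAcm (1 : E₀.Points ℂ)⟩ p _
      (Submodule.subset_span ⟨hc.pullback _, hpp.map_of_isSmoothProjective hf.isSmoothProjective_total hA _⟩))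

/-- **PIVOT: `HC_AV ⟺ F₂` modulo h₂₁ ALONE** — part XVIII-f's `HC_AV_iff_HC_CM_and_span_hodge_le_comap` with its redundant
conjunct `HC_CM` removed. `h₂₁` binder. research route, not a corollary; conditional on HC_CM plus one named minimal statement.
[cite: Andre1996Motifs, Lemme 6.3.1 (p. 31) and §6.3 a) (p. 33)] [cite: CharlesSchnell2014Notes, Prop. 11.3.5] -/
theorem HC_AV_iff_span_hodge_le_comap_of_andre1996 (h₂₁ : andre1996_cmAnchoredPencil) :
    PadicSemiregularLift.HodgeAbelianVarieties ↔
      ∀ ⦃d : ℕ⦄ ⦃𝒳 S : SchemeOver ℂ⦄ (f : 𝒳 ⟶ S) (hf : IsCompactAbelianPencil f d),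
        (cmLocus f d).Nonempty → ∀ (p : ℕ) (s : ComplexPoints S),
          Submodule.span ℂ {c : complexBetti 𝒳 (2 * p) | IsRationalClass c ∧ IsOfHodgeType (d + 1) 𝒳 (2 * p) p p c} ≤
            (algebraicClasses (fiberOver f s) p).comap (complexBetti.map (fiberι f s) (2 * p)).hom :=
  ⟨fun h ↦ ((HC_AV_iff_HC_CM_and_span_hodge_le_comap h₂₁).1 h).2,
    fun h ↦ (HC_AV_iff_HC_CM_and_span_hodge_le_comap h₂₁).2 ⟨HC_CM_of_span_hodge_le_comap h, h⟩⟩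

/-- Frame row: **F₂ is a `PivotAV`**, modulo h₂₁. [cite: Andre1996Motifs, Remarque 2 (p. 33)] -/
theorem pivotAV_spanHodgeLeComapCM_of_andre1996 (h₂₁ : andre1996_cmAnchoredPencil) :
    PivotAV (∀ ⦃d : ℕ⦄ ⦃𝒳 S : SchemeOver ℂ⦄ (f : 𝒳 ⟶ S) (hf : IsCompactAbelianPencil f d),
      (cmLocus f d).Nonempty → ∀ (p : ℕ) (s : ComplexPoints S),
        Submodule.span ℂ {c : complexBetti 𝒳 (2 * p) | IsRationalClass c ∧ IsOfHodgeType (d + 1) 𝒳 (2 * p) p p c} ≤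
          (algebraicClasses (fiberOver f s) p).comap (complexBetti.map (fiberι f s) (2 * p)).hom) :=
  pivotAV_iff.2 (HC_AV_iff_span_hodge_le_comap_of_andre1996 h₂₁).symm

/-! ## §4 F₃ — "the rational `(p,p)`-classes of the total space are algebraic modulo `ker j_t^*`" at CM points (part XVIII-f) -/

/-- **F₃ at `t` ⟹ (L)_t(p), unconditionally**: `C_t ≤ D_t = T_p(𝒳) ⊔ ker j_t^*` (parts XVII-f / XVIII-f §1, no hypothesis)
`≤ N^p(𝒳) ⊔ ker j_t^*`. (Part XVIII-f's `comap_le_sup_iff_span_hodge_le_sup_of_hodge` assumes HC on the fibre for the `⟺`;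
this direction needs nothing.) [cite: CharlesSchnell2014Notes, Prop. 11.3.5] [cite: Andre1996Motifs, §5.1 (p. 25)] -/
theorem comap_le_sup_of_span_hodge_le_sup (hf : IsCompactAbelianPencil f d) (p : ℕ) (t : ComplexPoints S)
    (h : Submodule.span ℂ {c : complexBetti 𝒳 (2 * p) | IsRationalClass c ∧ IsOfHodgeType (d + 1) 𝒳 (2 * p) p p c} ≤
      algebraicClasses 𝒳 p ⊔ LinearMap.ker (complexBetti.map (fiberι f t) (2 * p)).hom) :
    (algebraicClasses (fiberOver f t) p).comap (complexBetti.map (fiberι f t) (2 * p)).hom ≤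
      algebraicClasses 𝒳 p ⊔ LinearMap.ker (complexBetti.map (fiberι f t) (2 * p)).hom := by
  refine le_trans (comap_algebraicClasses_le_comap_hodgeSpan hf p t) ?_
  rw [comap_hodgeSpan_map_fiberι_eq_span_hodge_sup_ker hf p t]
  exact sup_le h le_sup_right

/-- **F₃ ⟹ (L) = `CMFibreAlgebraicLift`, unconditionally.** [cite: Andre1996Motifs, §5.1 and Remarque 2 (p. 33)] -/
theorem cmFibreAlgebraicLift_of_span_hodge_le_sup
    (h : ∀ ⦃d : ℕ⦄ ⦃𝒳 S : SchemeOver ℂ⦄ (f : 𝒳 ⟶ S), IsCompactAbelianPencil f d → ∀ (p : ℕ), ∀ t ∈ cmLocus f d,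
      Submodule.span ℂ {c : complexBetti 𝒳 (2 * p) | IsRationalClass c ∧ IsOfHodgeType (d + 1) 𝒳 (2 * p) p p c} ≤
        algebraicClasses 𝒳 p ⊔ LinearMap.ker (complexBetti.map (fiberι f t) (2 * p)).hom) :
    CMFibreAlgebraicLift :=
  cmFibreAlgebraicLift_iff_comap_le_sup.2 fun _ _ _ f hf p t ht ↦ comap_le_sup_of_span_hodge_le_sup hf p t (h f hf p t ht)

/-- **F₃ ⟹ `HC_CM`, NO named fact** (constant CM pencil: `pr₁^* c ∈ T_p(A × E₀) ≤ N^p ⊔ ker j_t^*`, so `j_t^* pr₁^* c = j_t^* a`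
with `a` algebraic on `A × E₀`, which restricts to an algebraic class of the fibre; i.e. `c` is algebraic on `A`).
[cite: Andre1996Motifs, §6.3 footnote (2) (p. 31)] [cite: Fulton1998, §10.1 and §19.2 Cor. 19.2 (b)] -/
theorem HC_CM_of_span_hodge_le_sup
    (h : ∀ ⦃d : ℕ⦄ ⦃𝒳 S : SchemeOver ℂ⦄ (f : 𝒳 ⟶ S), IsCompactAbelianPencil f d → ∀ (p : ℕ), ∀ t ∈ cmLocus f d,
      Submodule.span ℂ {c : complexBetti 𝒳 (2 * p) | IsRationalClass c ∧ IsOfHodgeType (d + 1) 𝒳 (2 * p) p p c} ≤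
        algebraicClasses 𝒳 p ⊔ LinearMap.ker (complexBetti.map (fiberι f t) (2 * p)).hom) :
    RankFourFaces.CMAbelianHodge := by
  intro A hA hAcm
  refine (hodgeConjectureFor_iff_of_isSmoothProjective nonempty_hodgeModel_holds hA).2 fun p c hc hpp ↦ ?_
  obtain ⟨E₀, ψ₀, hE₀, -⟩ := CMEndomorphism.exists_cmCurve_sqrt_neg 1 one_pos
  have hf : IsCompactAbelianPencil (CartesianMonoidalCategory.snd A.X E₀.X) A.dim :=
    isCompactAbelianPencil_snd A (isSmoothProjective_of_dim_eq' hE₀)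
  obtain ⟨e, he⟩ := exists_sliceFiberIso A.X (C := E₀.X) (1 : E₀.Points ℂ)
  refine mem_algebraicClasses_of_map_fiberι_map_fst_of_eq A he ?_
  obtain ⟨a, ha, k, hk, hak⟩ := Submodule.mem_sup.1 (h _ hf p _ (mem_cmLocus_snd A hAcm (1 : E₀.Points ℂ))
    (Submodule.subset_span ⟨hc.pullback _, hpp.map_of_isSmoothProjective hf.isSmoothProjective_total hA _⟩))
  rw [← hak, map_add, LinearMap.mem_ker.1 hk, add_zero]
  exact (map_algebraicClasses_le_inf_range hf _ p ⟨a, ha, rfl⟩).1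

/-- **`h₂₁ → F₃ → HC_AV` with NO `HC_CM`** (F₃ gives `HC_CM` and (L); André-axis part I's `HC_AV_of_HC_CM_and_cmFibreAlgebraicLift`).
`h₂₁` binder. research route, not a corollary; conditional on HC_CM plus one named minimal statement.
[cite: Andre1996Motifs, Lemme 6.3.1 (p. 31) and Remarque 2 (p. 33)] -/
theorem HC_AV_of_andre1996_of_span_hodge_le_sup (h₂₁ : andre1996_cmAnchoredPencil)
    (h : ∀ ⦃d : ℕ⦄ ⦃𝒳 S : SchemeOver ℂ⦄ (f : 𝒳 ⟶ S), IsCompactAbelianPencil f d → ∀ (p : ℕ), ∀ t ∈ cmLocus f d,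
      Submodule.span ℂ {c : complexBetti 𝒳 (2 * p) | IsRationalClass c ∧ IsOfHodgeType (d + 1) 𝒳 (2 * p) p p c} ≤
        algebraicClasses 𝒳 p ⊔ LinearMap.ker (complexBetti.map (fiberι f t) (2 * p)).hom) :
    PadicSemiregularLift.HodgeAbelianVarieties :=
  HC_AV_of_HC_CM_and_cmFibreAlgebraicLift h₂₁ (HC_CM_of_span_hodge_le_sup h) (cmFibreAlgebraicLift_of_span_hodge_le_sup h)

/-- **PIVOT: `HC_AV ⟺ F₃` modulo [h₂₁, hGT]** (the converse is part XI's `(L)` on-path row under Verdier with part XVIII-f's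
`HC_CM ⊢ (L) ⟺ F₃`). `h₂₁`, `hGT` binders. research route, not a corollary; conditional on HC_CM plus one named minimal statement.
[cite: Andre1996Motifs, Lemme 6.3.1 (p. 31)] [cite: Verdier1976, Cor. 5.1] [cite: CharlesSchnell2014Notes, Prop. 11.3.5] -/
theorem HC_AV_iff_span_hodge_le_sup_of_verdier (h₂₁ : andre1996_cmAnchoredPencil)
    (hGT : Verdier1976_genericLocalTriviality) :
    PadicSemiregularLift.HodgeAbelianVarieties ↔
      ∀ ⦃d : ℕ⦄ ⦃𝒳 S : SchemeOver ℂ⦄ (f : 𝒳 ⟶ S), IsCompactAbelianPencil f d → ∀ (p : ℕ), ∀ t ∈ cmLocus f d,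
        Submodule.span ℂ {c : complexBetti 𝒳 (2 * p) | IsRationalClass c ∧ IsOfHodgeType (d + 1) 𝒳 (2 * p) p p c} ≤
          algebraicClasses 𝒳 p ⊔ LinearMap.ker (complexBetti.map (fiberι f t) (2 * p)).hom :=
  ⟨fun h ↦ (cmFibreAlgebraicLift_iff_span_hodge_le_sup_of_HC_CM (HC_CM_of_HC_AV h)).1
      (cmFibreAlgebraicLift_of_HC_AV_of_verdier hGT h),
    HC_AV_of_andre1996_of_span_hodge_le_sup h₂₁⟩

/-- Frame row: **F₃ is a `PivotAV`**, modulo [h₂₁, hGT]. [cite: Andre1996Motifs, Remarque 2 (p. 33)] -/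
theorem pivotAV_spanHodgeLeSupCM_of_andre1996_of_verdier (h₂₁ : andre1996_cmAnchoredPencil)
    (hGT : Verdier1976_genericLocalTriviality) :
    PivotAV (∀ ⦃d : ℕ⦄ ⦃𝒳 S : SchemeOver ℂ⦄ (f : 𝒳 ⟶ S), IsCompactAbelianPencil f d → ∀ (p : ℕ), ∀ t ∈ cmLocus f d,
      Submodule.span ℂ {c : complexBetti 𝒳 (2 * p) | IsRationalClass c ∧ IsOfHodgeType (d + 1) 𝒳 (2 * p) p p c} ≤
        algebraicClasses 𝒳 p ⊔ LinearMap.ker (complexBetti.map (fiberι f t) (2 * p)).hom) :=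
  pivotAV_iff.2 (HC_AV_iff_span_hodge_le_sup_of_verdier h₂₁ hGT).symm

end Summit.HodgeConjecture.HodgeConjecture.Ring2.AbelianAll

end
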